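import Summits.ResolutionOfSingularities.ResolutionOfSingularities.Theses.UniversalCells
import Summits.ResolutionOfSingularities.ResolutionOfSingularities.Theorems.MatroidCellRes.Negative.OpenImmersionLoadBearing
import Summits.ResolutionOfSingularities.ResolutionOfSingularities.Theorems.MatroidCellRes.Negative.NonReducedGammaScheme
import Summits.ResolutionOfSingularities.ResolutionOfSingularities.Theorems.MatroidCellRes.Negative.IsIntegralLoadBearing
import Summits.ResolutionOfSingularities.ResolutionOfSingularities.Theorems.MatroidCellRes.Negative.ChartPresentation
import Summits.ResolutionOfSingularities.ResolutionOfSingularities.Theorems.MatroidCellRes.Negative.ChartPresentationDimension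
import Summits.ResolutionOfSingularities.ResolutionOfSingularities.Theorems.MatroidCellRes.Negative.SaturatedChartIntegralityLoadBearing
import Summits.ResolutionOfSingularities.ResolutionOfSingularities.Theorems.MatroidCellRes.Negative.IsRegularStrengtheningFalse
import Summits.ResolutionOfSingularities.ResolutionOfSingularities.Theorems.UniversalCellsMatroidCellResChartReduction
import Literature.AlgebraicGeometry.Resolution.HuGammaSchemeResolution
import Literature.AlgebraicGeometry.Resolution.PrincipalizationToResolution
import Literature.Barriers.ResolutionOfSingularities.InseparableBaseChangeResolution
import HarnessLib

/-!
# Disproof of `MatroidCellRes` (crux stmt-ResolutionOfSingularities-15230) — findings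

Work file of the crux DISPROVER (cdisprove seats: generation 1, cycle 1; GENERATION 2, cycle 1 — §8–§10; 2026-08-17) for
`Summit.ResolutionOfSingularities.ResolutionOfSingularities.Theses.UniversalCells.MatroidCellRes`
(route UniversalCells, rank 2): "for every prime `p`, every `m`, `Γ₊`, `Γ₀`, every INTEGRAL scheme
`W` open-immersed in the partial matroid stratum `P(p,m,Γ₊,Γ₀) = Spec (𝔽_p[a_ij : 3×m] ⧸ (Γ₀-minors
of [I₃|A]))[(∏_{Γ₊} minors)⁻¹]` is pointwise-locally resolvable".

## Findings (index; details in the docstrings below)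

* §1 `matroidCellRes_iff` — the crux is `MatroidCellResWith IsIntegral`, a member of the
  one-parameter family `MatroidCellResWith H` (hypothesis `H W` on the open-immersed scheme `W`).
* §2 NO UNCONDITIONAL KILL SHORT OF ¬SUMMIT: `matroidCellResWith_isReduced_of_summit`,
  `matroidCellRes_of_summit` — the summit conjunct `ResolutionOfSingularities` implies the crux, and
  even the crux with `IsIntegral W` WEAKENED to `IsReduced W` (such `W` are reduced, separated, of
  finite type over `𝔽_p`). Integrality is NOT load-bearing relative to the summit; it is
  load-bearing for Hu's METHOD (Hu2025 Lemma 7.3, the saturation step) and, by §3, SOME hypothesis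
  beyond "open in a stratum" is needed.
* §3 `IsIntegral W` CANNOT BE DROPPED — LANDED (p153834 `Negative/NonReducedGammaScheme.lean`,
  p154216 `Negative/IsIntegralLoadBearing.lean`): `matroidCellResWith_true_false`. NEW PHENOMENON
  FOUND: Γ-schemes are NON-REDUCED already at `m = 3` (six columns `e₀e₁e₂c₀c₁c₂`), char-free:
  `Γ₀ = {(c₀,c₁,c₂), (e₂,c₀,c₂), (e₁,e₂,c₂), (e₀,e₂,c₀), (e₀,e₁,c₁)}` has minors `det A`,
  `a₀₀a₁₂ - a₀₂a₁₀`, `a₀₂`, `-a₁₀`, `a₂₁`; modulo the entries the ideal is `(xw, xzv + ywu)`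
  (`x=a₀₀, y=a₀₁, z=a₁₁, w=a₁₂, u=a₂₀, v=a₂₂`) = five coordinate 4-planes, the plane `{x = w = 0}`
  carrying `𝔽_p[y^±,u^±,z^±,v^±][x]/(x²)` off the others; `f = ywu` is nilpotent (`f² ∈ I`) and
  non-zero in EVERY local ring of `D(yuzv)` (tangent vectors `S → (S⧸𝔮)[ε]`), so that open is
  nowhere reduced and none of its points has a resolvable neighbourhood.
* §4 `IsOpenImmersion i` is load-bearing: LANDED earlier by the crux-attack refuter (p149749,
  `Negative/OpenImmersionLoadBearing.lean`, Nagata's ring); re-exported.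
* §5 `p.Prime`: NOT load-bearing (documented only): for any `n : ℕ` an integral `W` open in
  `P(n,…)` has a prime characteristic `q ∣ n` (or `0` if `n = 0`) and is an open of the same stratum
  over `𝔽_q` (resp. a flat finite-type `ℤ`-scheme): the crux over all `n` = the crux ∧ its
  arithmetic analogue, conjecturally true; `n = 1` is vacuous (zero ring). Nothing to refute.
* §6 TIGHTNESS (documented only): the conclusion cannot be strengthened to `Scheme.IsRegular W` —
  `m = 2`, `Γ₀ = {(e₀,c₀,c₁)}` gives the quadric cone `a₁₀a₂₁ = a₁₁a₂₀` × 𝔸², integral and singular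
  along 𝔸² (the formal model `k⟦u,v,t⟧/(uv - t₁t₂)` is `DeJong1996.NodalFamilyRing k 4 2`, proved
  non-regular in tree: `NodalFamilyRing.not_isRegularLocalRing`); not formalised here (needs the
  polynomial-to-formal comparison). Global `HasResolution W` instead of local: summit-implied too.
* §7 THE LINE `birth` (lead prover-line-…-15230-0), stub (S″)
  `stub_noLocalIntegralGammaChartLocalRes`: conclusion summit-implied (no `stub-false` possible);
  hypothesis `hnochart` = the LOCAL FOLD-IN QUESTION. Disprover's assessment: integral Γ-schemes are
  SCARCE — `minor_eval_rankOne_eq_zero` (the rank-≤-1 matrices `R₁ ⊆ Z_Γ`, dim `m + 2`, for every `Γ`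
  without entry-minors; a separate component for rigid configurations, so `Z_{nb(M)}` is never
  integral for rigid simple `M` off the frame lines) and §3 (non-reduced strata at `m = 3`); hence
  `hnochart` is very likely SATISFIABLE and the cut "(E) Hu by name + (S″)" leaves in (S″) the
  singular germs of thin cells whose matroid variety has extra components — plausibly the whole
  crux again. Recommendation to the lead (evidence note `stubs/stub_noLocalIntegralGammaChartLocalRes.md`
  on the item): reshape (E) to the SATURATED/LOCALISED form of Hu's hypothesis (strategist's S⁺₁),
  under which (S″) disappears, rather than hoping (S″) is vacuous; any positive fold-in construction
  must use entry-minors (points forced onto frame lines), since `R₁` survives all other minors.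
* Compute: kit job j025101 (census of small Γ-ideals: Frobenius-linear nilpotent detection over
  `𝔽_2, 𝔽_3`, zero-divisor search; `m = 3` exhaustive over subsets of 2- and 3-minors, `m = 4` targeted,
  matroidal `Γ = nb(M)` for `n = 6, 7`) — queued at publication time; results will be attached to
  the item as evidence (how common are reduced / domain Γ-rings among small `Γ₀`).

* §6′ TIGHTNESS — NOW LANDED (generation 2, p163393 `Negative/IsRegularStrengtheningFalse.lean`):
  `matroidCellRes_isRegular_strengthening_false` — the crux with its conclusion strengthened to
  `Scheme.IsRegular W` is FALSE at every prime (`m = 2`, `Γ₀ = {(e₀,c₀,c₁)}`, the quadric cone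
  `a₁₀a₂₁ = a₁₁a₂₀` × 𝔸², = the strategist's `Z_{x₁₄₅}`, n = 5): integral by Mathlib's
  `MvPolynomial.irreducible_mul_X_add`, singular at `0` by the tree's Jacobian criterion
  (`not_isRegularLocalRing_localization_of_pderiv_eval_eq_zero`). Re-exported in §8.
* §8 (generation 2) STUB-LEVEL LOAD-BEARING TABLE for the registered line `birth` RESHAPE 4d
  (stubs (H) `stub_hu2025Thm13`, (N) `stub_saturatedEngineNonintegral`), every entry a theorem:
  (H) `IsDomain Q_Γ`: DROPPED ⇒ FALSE — LANDED p163450 `Negative.hu2025Thm13_false_without_isDomain`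
  (`Z_{Γ₀}` of §3 has no proper birational smooth-source modification); WEAKENED to `IsReduced` (in
  the `HasResolution` form the line consumes) ⇒ summit-implied (`hu_isReduced_form_of_summit`).
  (N) `hdom : IsDomain (Q_Γ)_g`: DROPPED ⇒ FALSE even keeping saturation, `¬IsDomain Q_Γ`, singular,
  dim ≥ 2 — LANDED p163450 `Negative.stub_saturatedEngineNonintegral_false_without_hdom` (the
  SATURATION `Γ = {u | x_u = 0 in (Q_{Γ₀})_{g₀}}` of §3's nowhere-reduced chart, exactly as glue
  stub (B) saturates; the saturated chart is presented by the five relations + the unit `g`, so it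
  keeps the nilpotent `ywu` with annihilator in every prime — `Negative/ChartPresentation.lean`
  p162932, dimension ≥ 2 by `Negative/ChartPresentationDimension.lean` p162965);
  `hnd`, `hsat`, `hsing`, `hdim`: each DROPPABLE under the summit (`residue_with_only_hdom_of_summit`,
  = tree `hasResolution_away_of_resolutionOfSingularities`, p158618). So integrality of the CHART is
  the single load-bearing hypothesis of (N) and of S⁺₁; everything else is bookkeeping of the cut.
* §9 (generation 2) THE LEAD'S (N)-WITNESS, cross-checked (lead c3, `…ResidueWitnessMinors.lean`
  p161109, files 2–3 pending at the time of writing): the complete quadrilateral `A₀` (m = 4, p ≠ 2),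
  `Γ = {u | x_u(A₀) = 0}`, chart `D(a₀₀)`. Disprover's independent derivation, recorded as ring
  identities: `a₀₀ · (a₁₁a₀₂a₂₃ - a₀₁a₂₂a₁₃) = l₁·a₀₂a₂₃ + l₂·a₀₁a₁₃ + l₃·a₀₁a₀₂`
  (`quadrilateral_zeroDivisor_identity`) — so `a₀₀` and `g' := a₁₁a₀₂a₂₃ - a₀₁a₂₂a₁₃` are zero
  divisors of `Q_Γ` (`a₀₀ ∉ I_Γ` by the point `A₀`, `g' ∉ I_Γ` by the point `c₀ = 0, c₁ = (1,2,0),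
  c₂ = (1,0,1), c₃ = (0,1,1)` of `Z_Γ`, where `g' = 2 - 1 = 1`; both kill the six lines), i.e.
  `Z_Γ ⊇` the junk component `{c₀ = 0}` of the same dimension 6; on `D(a₀₀)`, `l₁, l₂` solve
  `a₁₁, a₂₂` and the chart is `𝔽_p[a₀₀^±, a₀₁, a₀₂][a₁₀, a₂₀, a₁₃, a₂₃]/(l₃)` — the quadric cone
  of §6′ times a torus: integral, singular exactly along the RANK-ONE points
  `c₀ ∈ 𝔽_p e₀, c₁, c₂ ∈ 𝔽_p e₀, c₃ = 0` (the `R₁` locus of §7, as predicted), dimension 6.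
  VERDICT: the witness is correct; (N) is NOT vacuous (for p ≠ 2; at p = 2 the diagonal points of
  `A₀` are collinear — Fano — and `Γ(A₀)` gains the seventh line, so a p = 2 witness needs another
  configuration; (N) being `∀ p`, one prime suffices for non-vacuity). Consequence for planning: the
  crux is NOT (H)-by-name ∧ bookkeeping; the residue is honest, and by §8 its only load-bearing
  hypothesis is chart integrality — the hypothesis Hu's Lemma 7.3 consumes.
* §10 (generation 2) WHAT RESISTS AND WHY; next attacks. No unconditional kill exists short of
  ¬summit (§2). Every hypothesis of the crux and of both stubs is now classified (load-bearing with a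
  landed `¬`, or summit-droppable with a proof). Remaining finite-horizon attacks are on Hu's PROOF,
  not on any Lean statement: (a) the engine test at n = 5 on exactly §6′'s `Z_{x₁₄₅}` (Hu 2025
  §4–§8; the hub toolbelt has sympy/python-flint only — no Singular/Macaulay2 — so a hand-rolled
  chart-by-chart Gröbner script is the cost); (b) minimality of the lead's witness: is there an
  (N)-instance with m = 3 (n = 6)? (a sympy census over saturated Γ ⊆ 20 column-triples, 9
  variables, is feasible as ONE kit job; not run this cycle); (c) a p = 2 (N)-witness (non-Fano
  configuration). Compute job j025176 of generation 1 finished `ok` (115 s) but its artefacts are not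
  readable from this seat's jail; nothing here depends on it.

Axioms of every theorem here: `propext`, `Classical.choice`, `Quot.sound`. No `sorry`.
-/

noncomputable section

-- single-problem summit: the doubled namespace component `ResolutionOfSingularities` is forced
set_option linter.dupNamespace false

open CategoryTheory AlgebraicGeometry TopologicalSpace Literature.AlgebraicGeometry.Resolution

namespace Summit.ResolutionOfSingularities.ResolutionOfSingularities.Cruxes.MatroidCellRes.Disproof

open Summit.ResolutionOfSingularities.ResolutionOfSingularities.Theses.UniversalCells (MatroidCellRes)
open Summit.ResolutionOfSingularities.ResolutionOfSingularities.Theorems.MatroidCellRes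

/-! ## §0 The universal family, named (definitionally the two `let`s of the crux) -/

/-- The universal `3 × (3 + m)` matrix `[I₃ | A]` over `𝔽_p[a_ij]`. [cite: Hu2025, §2.1–2.2] -/
abbrev univMatrix (p m : ℕ) :
    Matrix (Fin 3) (Fin 3 ⊕ Fin m) (MvPolynomial (Fin 3 × Fin m) (ZMod p)) :=
  Matrix.fromCols 1 (Matrix.of fun i j => MvPolynomial.X (i, j))

/-- The `3 × 3` minor of `[I₃ | A]` on the column triple `u` (de-homogenised Plücker coordinate).
[cite: Hu2025, §2.2] -/
abbrev minor (p m : ℕ) (u : Fin 3 → Fin 3 ⊕ Fin m) : MvPolynomial (Fin 3 × Fin m) (ZMod p) :=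
  ((univMatrix p m).submatrix id u).det

/-- The Γ-ideal: the minors indexed by `Γ₀`. [cite: Hu2025, §1.5] -/
abbrev gammaIdeal (p m : ℕ) (Γ0 : Set (Fin 3 → Fin 3 ⊕ Fin m)) :
    Ideal (MvPolynomial (Fin 3 × Fin m) (ZMod p)) :=
  Ideal.span (minor p m '' Γ0)

/-- Coordinate ring of the Γ-scheme `Z_{Γ₀}`. [cite: Hu2025, §1.5] -/
abbrev GammaRing (p m : ℕ) (Γ0 : Set (Fin 3 → Fin 3 ⊕ Fin m)) : Type :=
  MvPolynomial (Fin 3 × Fin m) (ZMod p) ⧸ gammaIdeal p m Γ0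

/-- Coordinate ring of the partial matroid stratum `P(p,m,Γ₊,Γ₀)` (target of `i` in the crux).
[folklore] -/
abbrev StratumRing (p m : ℕ) (Γp : Finset (Fin 3 → Fin 3 ⊕ Fin m))
    (Γ0 : Set (Fin 3 → Fin 3 ⊕ Fin m)) : Type :=
  Localization.Away (Ideal.Quotient.mk (gammaIdeal p m Γ0) (∏ u ∈ Γp, minor p m u))

/-- Pointwise-local resolvability of a scheme (the crux's conclusion shape). [folklore] -/
def LocallyResolvable (W : Scheme.{0}) : Prop :=
  ∀ w : W, ∃ W' : W.Opens, w ∈ W' ∧ Scheme.HasResolution (W' : Scheme.{0})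

/-! ## §1 The one-parameter family `MatroidCellResWith H` -/

/-- The crux with its hypothesis `IsIntegral W` replaced by an arbitrary predicate `H` on the
open-immersed scheme `W`. `H = IsIntegral` is the crux (`matroidCellRes_iff`), `H = IsReduced` is
still implied by the summit (§2), `H = ⊤` is FALSE (§3). [folklore] -/
def MatroidCellResWith (H : Scheme.{0} → Prop) : Prop :=
  ∀ p : ℕ, p.Prime → ∀ (m : ℕ) (Γp : Finset (Fin 3 → Fin 3 ⊕ Fin m))
    (Γ0 : Set (Fin 3 → Fin 3 ⊕ Fin m)),
    ∀ (W : Scheme.{0}) (i : W ⟶ Spec (.of (StratumRing p m Γp Γ0))),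
      IsOpenImmersion i → H W → LocallyResolvable W

/-- The crux IS `MatroidCellResWith IsIntegral`, definitionally. [folklore] -/
theorem matroidCellRes_iff : MatroidCellRes ↔ MatroidCellResWith (fun W => IsIntegral W) :=
  Iff.rfl

/-! ## §2 Summit ⇒ crux, even with `IsIntegral` weakened to `IsReduced` -/

/-- The structure map of the stratum to `Spec 𝔽_p` is locally of finite type (quotient of a
polynomial ring in `3m` variables, then a localisation away from one element). [folklore] -/
theorem locallyOfFiniteType_stratum (p m : ℕ) [Fact p.Prime] (Γp : Finset (Fin 3 → Fin 3 ⊕ Fin m))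
    (Γ0 : Set (Fin 3 → Fin 3 ⊕ Fin m)) :
    LocallyOfFiniteType (Spec.map (CommRingCat.ofHom
      (algebraMap (ZMod p) (StratumRing p m Γp Γ0)))) := by
  rw [HasRingHomProperty.Spec_iff (P := @LocallyOfFiniteType)]
  have h1 : (algebraMap (ZMod p) (GammaRing p m Γ0)).FiniteType :=
    RingHom.finiteType_algebraMap.mpr inferInstance
  have h2 : (algebraMap (GammaRing p m Γ0) (StratumRing p m Γp Γ0)).FiniteType :=
    RingHom.finiteType_holdsForLocalizationAway (StratumRing p m Γp Γ0)
      (Ideal.Quotient.mk (gammaIdeal p m Γ0) (∏ u ∈ Γp, minor p m u))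
  have h := h2.comp h1
  rw [← IsScalarTower.algebraMap_eq] at h
  simpa using h

/-- **Summit ⇒ the crux with `IsIntegral W` weakened to `IsReduced W`.** A reduced `W` open-immersed
in a stratum is a reduced, separated, finite-type `𝔽_p`-scheme (open in an affine scheme of finite
type over `𝔽_p`, whose underlying space is Noetherian), so `ResolutionInChar p` resolves `W` itself
and `W' = W` is the neighbourhood. Hence NO refutation of the crux, nor of this weakening, exists
unless resolution of singularities in characteristic `p` fails. [folklore] -/
theorem matroidCellResWith_isReduced_of_summit (hS : _root_.ResolutionOfSingularities) :
    MatroidCellResWith (fun W => IsReduced W) := by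
  intro p hp m Γp Γ0 W i hi hred w
  haveI : Fact p.Prime := ⟨hp⟩
  haveI := hi
  haveI : IsReduced W := hred
  haveI := locallyOfFiniteType_stratum p m Γp Γ0
  let f : W ⟶ Spec (.of (ZMod p)) :=
    i ≫ Spec.map (CommRingCat.ofHom (algebraMap (ZMod p) (StratumRing p m Γp Γ0)))
  haveI : LocallyOfFiniteType f := inferInstance
  haveI : IsSeparated f := inferInstance
  haveI : NoetherianSpace W := i.isOpenEmbedding.isInducing.noetherianSpace
  haveI : QuasiCompact f := inferInstance
  have hres : Scheme.HasResolution W := hS p hp (ZMod p) W f ‹_› ‹_› ‹_› ‹_›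
  exact ⟨⊤, trivial, hres.restrict ⊤⟩

/-- **Summit ⇒ crux** (`IsIntegral W ⇒ IsReduced W`). An unconditional `¬ MatroidCellRes` would be
`¬ ResolutionOfSingularities`. [folklore] -/
theorem matroidCellRes_of_summit (hS : _root_.ResolutionOfSingularities) : MatroidCellRes := by
  rw [matroidCellRes_iff]
  intro p hp m Γp Γ0 W i hi hint
  haveI := hint
  exact matroidCellResWith_isReduced_of_summit hS p hp m Γp Γ0 W i hi inferInstance

/-! ## §3 `IsIntegral W` cannot be dropped — LANDED (p153834, p154216) -/

/-- **`MatroidCellResWith ⊤` is FALSE** (no hypothesis on the open-immersed `W` at all): the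
stratum `P(p, 3, ∅, Γ₀)`, `Γ₀ = {(c₀,c₁,c₂), (e₂,c₀,c₂), (e₁,e₂,c₂), (e₀,e₂,c₀), (e₀,e₁,c₁)}`, is
nowhere reduced on the non-empty open `D(a₀₁a₂₀a₁₁a₂₂)`, and a resolution is an isomorphism over a
dense, hence somewhere reduced, open. Landed as
`Theorems.MatroidCellRes.Negative.matroidCellRes_false_without_isIntegral` (+ `_at` every prime);
the algebra (minors, certificates `(ywu)² = 0`, `x²zv = 0`, `w²yu = 0`, tangent vectors) in
`Negative/NonReducedGammaScheme.lean`. [folklore] -/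
theorem matroidCellResWith_true_false : ¬ MatroidCellResWith (fun _ => True) := by
  intro H
  refine Negative.matroidCellRes_false_without_isIntegral ?_
  intro p hp m Γp Γ0 M I W i hi w
  exact H p hp m Γp Γ0 W i hi trivial w

/-- The Γ-RING of that example is not reduced (so not a domain: the Γ-scheme `Z_{Γ₀} ⊂ 𝔸⁹_{𝔽_p}`
is neither reduced nor integral, for every prime `p`): `f = a₀₁a₁₂a₂₀` is a non-zero nilpotent.
Non-vanishing of `f` is read off the `𝔽_p[ε]`-point `a₀₁ = a₂₀ = a₁₁ = a₂₂ = 1`, `a₀₀ = ε`,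
`a₁₂ = -ε`, all other entries `0` (a tangent vector at a point of `D(yuzv)`: it lies on `Z_{Γ₀}`
and `f ↦ -ε ≠ 0`). [folklore] -/
theorem gammaRing_example_not_isReduced (p : ℕ) [Fact p.Prime] :
    ¬ _root_.IsReduced (GammaRing p 3 {![Sum.inr 0, Sum.inr 1, Sum.inr 2],
      ![Sum.inl 2, Sum.inr 0, Sum.inr 2], ![Sum.inl 1, Sum.inl 2, Sum.inr 2],
      ![Sum.inl 0, Sum.inl 2, Sum.inr 0], ![Sum.inl 0, Sum.inl 1, Sum.inr 1]}) := by
  intro hred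
  set Γ0 : Set (Fin 3 → Fin 3 ⊕ Fin 3) := {![Sum.inr 0, Sum.inr 1, Sum.inr 2],
      ![Sum.inl 2, Sum.inr 0, Sum.inr 2], ![Sum.inl 1, Sum.inl 2, Sum.inr 2],
      ![Sum.inl 0, Sum.inl 2, Sum.inr 0], ![Sum.inl 0, Sum.inl 1, Sum.inr 1]} with hΓ0
  have hI := Negative.gammaIdeal_example_eq p
  -- the `𝔽_p[ε]`-point
  let val : Fin 3 × Fin 3 → DualNumber (ZMod p) := fun ij =>
    (![![DualNumber.eps, 1, 0], ![0, 1, -DualNumber.eps], ![1, 0, 1]] :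
      Fin 3 → Fin 3 → DualNumber (ZMod p))
      ij.1 ij.2
  let ψ : MvPolynomial (Fin 3 × Fin 3) (ZMod p) →+* DualNumber (ZMod p) :=
    MvPolynomial.eval₂Hom (algebraMap (ZMod p) (DualNumber (ZMod p))) val
  have hψX : ∀ ij, ψ (MvPolynomial.X ij) = val ij := fun ij =>
    MvPolynomial.eval₂Hom_X' _ val ij
  have hker : ∀ a ∈ gammaIdeal p 3 Γ0, ψ a = 0 := by
    have hle : gammaIdeal p 3 Γ0 ≤ RingHom.ker ψ := by
      rw [show gammaIdeal p 3 Γ0 = _ from hI]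
      refine Ideal.span_le.mpr ?_
      rintro a ha
      simp only [Set.mem_insert_iff, Set.mem_singleton_iff] at ha
      rcases ha with rfl | rfl | rfl | rfl | rfl <;>
        simp only [RingHom.mem_ker, SetLike.mem_coe, map_sub, map_add, map_mul, map_neg, hψX] <;>
        simp [val]
    exact fun a ha => hle ha
  let φ : GammaRing p 3 Γ0 →+* DualNumber (ZMod p) := Ideal.Quotient.lift _ ψ hker
  -- `f` is nilpotent in the Γ-ring: the five relations hold there, then `ywu_sq_eq_zero`
  have hrel : ∀ a ∈ ({MvPolynomial.X (0,0) * MvPolynomial.X (1,1) * MvPolynomial.X (2,2)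
        - MvPolynomial.X (0,0) * MvPolynomial.X (1,2) * MvPolynomial.X (2,1)
        - MvPolynomial.X (0,1) * MvPolynomial.X (1,0) * MvPolynomial.X (2,2)
        + MvPolynomial.X (0,1) * MvPolynomial.X (1,2) * MvPolynomial.X (2,0)
        + MvPolynomial.X (0,2) * MvPolynomial.X (1,0) * MvPolynomial.X (2,1)
        - MvPolynomial.X (0,2) * MvPolynomial.X (1,1) * MvPolynomial.X (2,0),
        MvPolynomial.X (0,0) * MvPolynomial.X (1,2) - MvPolynomial.X (0,2) * MvPolynomial.X (1,0),
        MvPolynomial.X (0,2), - MvPolynomial.X (1,0), MvPolynomial.X (2,1)} :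
          Set (MvPolynomial (Fin 3 × Fin 3) (ZMod p))),
      Ideal.Quotient.mk (gammaIdeal p 3 Γ0) a = 0 := fun a ha =>
    Ideal.Quotient.eq_zero_iff_mem.mpr
      (by rw [show gammaIdeal p 3 Γ0 = _ from hI]; exact Ideal.subset_span ha)
  have d := hrel (MvPolynomial.X (0,0) * MvPolynomial.X (1,1) * MvPolynomial.X (2,2)
        - MvPolynomial.X (0,0) * MvPolynomial.X (1,2) * MvPolynomial.X (2,1)
        - MvPolynomial.X (0,1) * MvPolynomial.X (1,0) * MvPolynomial.X (2,2)
        + MvPolynomial.X (0,1) * MvPolynomial.X (1,2) * MvPolynomial.X (2,0)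
        + MvPolynomial.X (0,2) * MvPolynomial.X (1,0) * MvPolynomial.X (2,1)
        - MvPolynomial.X (0,2) * MvPolynomial.X (1,1) * MvPolynomial.X (2,0)) (by simp)
  have m2 := hrel (MvPolynomial.X (0,0) * MvPolynomial.X (1,2)
    - MvPolynomial.X (0,2) * MvPolynomial.X (1,0)) (by simp)
  have e1 := hrel (MvPolynomial.X (0,2)) (by simp)
  have e2' := hrel (- MvPolynomial.X (1,0)) (by simp)
  have e3 := hrel (MvPolynomial.X (2,1)) (by simp)
  have e2 : Ideal.Quotient.mk (gammaIdeal p 3 Γ0) (MvPolynomial.X (1,0)) = 0 := by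
    rwa [map_neg, neg_eq_zero] at e2'
  simp only [map_sub, map_add, map_mul] at d m2
  have hf2 : (Ideal.Quotient.mk (gammaIdeal p 3 Γ0)
      (MvPolynomial.X (0,1) * MvPolynomial.X (1,2) * MvPolynomial.X (2,0))) ^ 2 = 0 := by
    rw [map_mul, map_mul]
    exact Negative.ywu_sq_eq_zero _ _ _ _ _ _ _ _ _ d m2 e1 e2 e3
  -- but `f ↦ -ε ≠ 0`
  have hf0 : Ideal.Quotient.mk (gammaIdeal p 3 Γ0)
      (MvPolynomial.X (0,1) * MvPolynomial.X (1,2) * MvPolynomial.X (2,0)) = 0 :=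
    hred.eq_zero _ ⟨2, hf2⟩
  have h := congrArg φ hf0
  rw [map_zero, Ideal.Quotient.lift_mk] at h
  simp only [map_mul, hψX] at h
  have h' := congrArg TrivSqZeroExt.snd h
  simp [val] at h'

/-! ## §4 `IsOpenImmersion i` is load-bearing (landed, p149749) -/

/-- Re-export of the landed negative lemma: with `IsOpenImmersion i` dropped the crux is false
(Nagata's one-dimensional local domain maps to the stratum `Spec 𝔽_p`, `m = 0`).
[cite: Kollar2007, Example 1.103 and Thm. 1.101] -/
theorem matroidCellRes_false_without_isOpenImmersion' :
    ¬ ∀ p : ℕ, p.Prime → ∀ (m : ℕ) (Γp : Finset (Fin 3 → Fin 3 ⊕ Fin m))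
        (Γ0 : Set (Fin 3 → Fin 3 ⊕ Fin m)),
      ∀ (W : Scheme.{0}) (_ : W ⟶ Spec (.of (StratumRing p m Γp Γ0))),
        IsIntegral W → LocallyResolvable W :=
  Negative.matroidCellRes_false_without_isOpenImmersion

/-! ## §7 The line `birth`, stub (S″): the local fold-in question -/

/-- Two proportional columns kill a determinant (multilinearity + alternation). [folklore] -/
theorem det_eq_zero_of_two_columns_smul {K : Type*} [CommRing K] {n : Type*} [Fintype n]
    [DecidableEq n] (N : Matrix n n K) (v : n → K) {b₁ b₂ : n} (hb : b₁ ≠ b₂) (s₁ s₂ : K)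
    (h₁ : ∀ k, N k b₁ = s₁ * v k) (h₂ : ∀ k, N k b₂ = s₂ * v k) : N.det = 0 := by
  have hN : N = (N.updateCol b₁ v |>.updateCol b₂ v |>.updateCol b₁ (s₁ • v)).updateCol b₂
      (s₂ • v) := by
    ext k b
    by_cases hkb₂ : b = b₂
    · subst hkb₂; simp [h₂, smul_eq_mul]
    · by_cases hkb₁ : b = b₁
      · subst hkb₁; simp [hb, h₁, smul_eq_mul]
      · simp [hkb₁, hkb₂]
  rw [hN, Matrix.det_updateCol_smul, Matrix.updateCol_comm _ hb, Matrix.det_updateCol_smul]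
  have : ((((N.updateCol b₁ v).updateCol b₂ v).updateCol b₂ v).updateCol b₁ v).det = 0 := by
    refine Matrix.det_zero_of_column_eq hb (fun k => ?_)
    simp [Matrix.updateCol_apply]
  rw [this, mul_zero, mul_zero]

/-- **Rank-one points of Γ-schemes.** Every minor of `[I₃ | A]` with at least two `A`-columns
vanishes at a rank-one point `a_ij = v_i c_j` (over any `𝔽_p`-algebra `K`): the closed subset
`R₁ = {rank A ≤ 1}` (dimension `m + 2`) lies in every Γ-scheme `Z_Γ` whose `Γ` has NO entry-minor
`(e_a, e_b, c_k)`. For a rigid configuration `M` (thin cell = one torus orbit, dimension `m + 2`,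
generic rank `3`) `R₁` is therefore a second irreducible component of the same dimension:
`Z_{nb(M)}` is reducible for every rigid simple `M` with no point on a frame line — the reason the
disprover expects the hypothesis `hnochart` of stub (S″) to be satisfiable, and why any positive
"fold-in" construction must force points onto frame lines. [folklore] -/
theorem minor_eval_rankOne_eq_zero (p m : ℕ) {K : Type} [CommRing K] [Algebra (ZMod p) K]
    (v : Fin 3 → K) (c : Fin m → K) (u : Fin 3 → Fin 3 ⊕ Fin m)
    (hu : ∃ b₁ b₂ : Fin 3, b₁ ≠ b₂ ∧ (∃ j₁, u b₁ = Sum.inr j₁) ∧ (∃ j₂, u b₂ = Sum.inr j₂)) :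
    MvPolynomial.aeval (fun ij : Fin 3 × Fin m => v ij.1 * c ij.2) (minor p m u) = 0 := by
  obtain ⟨b₁, b₂, hb, ⟨j₁, hj₁⟩, ⟨j₂, hj₂⟩⟩ := hu
  rw [AlgHom.map_det]
  refine det_eq_zero_of_two_columns_smul _ v hb (c j₁) (c j₂) (fun k => ?_) (fun k => ?_)
  · simp [Matrix.submatrix_apply, hj₁, Matrix.fromCols_apply_inr, mul_comm]
  · simp [Matrix.submatrix_apply, hj₂, Matrix.fromCols_apply_inr, mul_comm]

/-- **The local fold-in question** (hypothesis side of stub (S″), as a `Prop`): does every singular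
point of every integral `W` open in a Γ-scheme have a neighbourhood that open-immerses into an
INTEGRAL Γ-scheme (any number of columns)? If yes, (S″) is vacuous and the crux is Hu's claim
alone; the disprover's evidence (`minor_eval_rankOne_eq_zero`, §3) points to NO. Recorded for the
ideators; neither direction is a Lean-sized task. [folklore] -/
def LocalFoldIn : Prop :=
  ∀ p : ℕ, p.Prime → ∀ (m : ℕ) (Γ0 : Set (Fin 3 → Fin 3 ⊕ Fin m))
    (W : Scheme.{0}) (j : W ⟶ Spec (.of (GammaRing p m Γ0))),
    IsOpenImmersion j → IsIntegral W → ∀ w : W, ¬ IsRegularLocalRing (W.presheaf.stalk w) →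
      ∃ (U : W.Opens) (_ : w ∈ U) (m' : ℕ) (Γ' : Set (Fin 3 → Fin 3 ⊕ Fin m'))
        (j' : (U : Scheme.{0}) ⟶ Spec (.of (GammaRing p m' Γ'))),
        IsDomain (GammaRing p m' Γ') ∧ IsOpenImmersion j'

/-! ## §6′ Tightness — landed (generation 2, p163393) -/

/-- Re-export: the crux's conclusion cannot be strengthened to `Scheme.IsRegular W` (quadric cone
`a₁₀a₂₁ = a₁₁a₂₀` × 𝔸², `m = 2`, every prime). [folklore] -/
theorem matroidCellRes_isRegular_strengthening_false' :
    ¬ ∀ p : ℕ, p.Prime → ∀ (m : ℕ) (Γp : Finset (Fin 3 → Fin 3 ⊕ Fin m))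
        (Γ0 : Set (Fin 3 → Fin 3 ⊕ Fin m)),
      ∀ (W : Scheme.{0}) (i : W ⟶ Spec (.of (StratumRing p m Γp Γ0))),
        IsOpenImmersion i → IsIntegral W → Scheme.IsRegular W :=
  Negative.matroidCellRes_isRegular_strengthening_false

/-! ## §8 Stub-level load-bearing table for line `birth`, RESHAPE 4d (generation 2) -/

/-- **(H) without `IsDomain` is false** — re-export of the landed negative lemma (p163450).
[folklore] -/
theorem hu2025Thm13_false_without_isDomain' :
    ¬ ∀ (p : ℕ) [Fact p.Prime] (m : ℕ) (Γ : Set (Fin 3 → Fin 3 ⊕ Fin m)),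
        ∃ (Z' : Scheme.{0}) (π : Z' ⟶ Spec (.of (HuGamma.ring (ZMod p) m Γ))),
          IsProper π ∧ IsBirational π ∧ Smooth (π ≫ HuGamma.toBase (ZMod p) m Γ) :=
  Negative.hu2025Thm13_false_without_isDomain

/-- **(H) with `IsDomain` weakened to `IsReduced`, in the `HasResolution` form the line consumes
(`stub_integralGammaRes`), is summit-implied**: a reduced Γ-scheme is a reduced separated
`𝔽_p`-scheme of finite type. (The printed `Smooth`-source form would in addition need regular ⇒
smooth over the perfect field `𝔽_p`; not needed by the line.) [folklore] -/
theorem hu_isReduced_form_of_summit (hS : _root_.ResolutionOfSingularities) (p : ℕ) [hp : Fact p.Prime]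
    (m : ℕ) (Γ : Set (Fin 3 → Fin 3 ⊕ Fin m)) (hred : _root_.IsReduced (HuGamma.ring (ZMod p) m Γ)) :
    Scheme.HasResolution (Spec (.of (HuGamma.ring (ZMod p) m Γ))) := by
  let f : Spec (.of (HuGamma.ring (ZMod p) m Γ)) ⟶ Spec (.of (ZMod p)) := HuGamma.toBase (ZMod p) m Γ
  haveI : LocallyOfFiniteType f := by
    show LocallyOfFiniteType (Spec.map _)
    rw [HasRingHomProperty.Spec_iff (P := @LocallyOfFiniteType)]
    exact RingHom.finiteType_algebraMap.mpr inferInstance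
  haveI : IsSeparated f := inferInstance
  haveI : QuasiCompact f := inferInstance
  haveI : IsReduced (Spec (.of (HuGamma.ring (ZMod p) m Γ))) := inferInstance
  exact hS p hp.out (ZMod p) _ f ‹_› ‹_› ‹_› ‹_›

/-- **(N) without `hdom` is false** — re-export of the landed negative lemma (p163450): chart
integrality cannot be dropped from the residue stub even keeping saturation, `¬ IsDomain Q_Γ`,
singularity and dimension `≥ 2`. [folklore] -/
theorem stub_saturatedEngineNonintegral_false_without_hdom' :
    ¬ ∀ p : ℕ, p.Prime → ∀ (m : ℕ) (Γ : Set (Fin 3 → Fin 3 ⊕ Fin m)),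
      ¬ IsDomain (GammaRing p m Γ) →
      ∀ (g : GammaRing p m Γ),
        (∀ u : Fin 3 → Fin 3 ⊕ Fin m, u ∉ Γ →
            algebraMap (GammaRing p m Γ) (Localization.Away g)
              (Ideal.Quotient.mk (gammaIdeal p m Γ) (minor p m u)) ≠ 0) →
          ¬ IsRegularRing (Localization.Away g) →
            ¬ topologicalKrullDim (Spec (.of (Localization.Away g))) ≤ 1 →
              Scheme.HasResolution (Spec (.of (Localization.Away g))) :=
  Negative.stub_saturatedEngineNonintegral_false_without_hdom

/-- **(N) with everything but `hdom` dropped is summit-implied**: `hnd`, `hsat`, `hsing`, `hdim`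
are each removable (tree: `hasResolution_away_of_resolutionOfSingularities`, p158618). Together
with the previous theorem: `hdom` is THE load-bearing hypothesis of the residue and of S⁺₁.
[folklore] -/
theorem residue_with_only_hdom_of_summit (hS : _root_.ResolutionOfSingularities) (p : ℕ)
    (hp : p.Prime) (m : ℕ) (Γ : Set (Fin 3 → Fin 3 ⊕ Fin m)) (g : GammaRing p m Γ)
    (hdom : IsDomain (Localization.Away g)) :
    Scheme.HasResolution (Spec (.of (Localization.Away g))) :=
  hasResolution_away_of_resolutionOfSingularities hS p hp m (gammaIdeal p m Γ) g hdom

/-! ## §9 The lead's (N)-witness (complete quadrilateral), cross-checked (generation 2) -/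

/-- **Zero-divisor certificate for the complete quadrilateral's Γ-ring.** With the three line
quadrics `l₁ = a₀₀a₁₁ - a₀₁a₁₀`, `l₂ = a₀₂a₂₀ - a₀₀a₂₂`, `l₃ = a₁₀a₂₃ - a₁₃a₂₀` (the other three
lines kill `a₂₁, a₁₂, a₀₃`): `a₀₀ · (a₁₁a₀₂a₂₃ - a₀₁a₂₂a₁₃) = l₁·a₀₂a₂₃ + l₂·a₀₁a₁₃ + l₃·a₀₁a₀₂`
in any commutative ring. Hence `a₀₀ · g' ∈ I_Γ` while `a₀₀ ∉ I_Γ` (the point `A₀`, `a₀₀ = 1`) and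
`g' ∉ I_Γ` (the point `c₀ = 0, c₁ = (1,2,0), c₂ = (1,0,1), c₃ = (0,1,1)`, on all six lines, with
`g' = 2·1·1 - 1·1·1 = 1`): `Q_Γ` is not a domain — the junk component `{c₀ = 0}`. On `D(a₀₀)` the
relations `l₁, l₂` solve `a₁₁, a₂₂`, leaving the quadric cone `l₃ = 0` times a torus: the lead's
chart is integral and singular along the rank-one points. (Verification of the lead's claim; the
lead's own files carry the scheme-theoretic statements.) [folklore] -/
theorem quadrilateral_zeroDivisor_identity {A : Type*} [CommRing A]
    (a₀₀ a₀₁ a₀₂ a₁₀ a₁₁ a₁₃ a₂₀ a₂₂ a₂₃ : A) :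
    a₀₀ * (a₁₁ * a₀₂ * a₂₃ - a₀₁ * a₂₂ * a₁₃) =
      (a₀₀ * a₁₁ - a₀₁ * a₁₀) * (a₀₂ * a₂₃) + (a₀₂ * a₂₀ - a₀₀ * a₂₂) * (a₀₁ * a₁₃)
        + (a₁₀ * a₂₃ - a₁₃ * a₂₀) * (a₀₁ * a₀₂) := by
  ring

/-- The test point for `g' ∉ I_Γ`: with `c₀ = 0`, `c₁ = (1,2,0)`, `c₂ = (1,0,1)`, `c₃ = (0,1,1)`
all six line forms vanish and `g' = 1` (integers; any characteristic by base change). [folklore] -/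
theorem quadrilateral_junk_point :
    let a : Fin 3 → Fin 4 → ℤ := ![![0, 1, 1, 0], ![0, 2, 0, 1], ![0, 0, 1, 1]]
    (a 0 0 * a 1 1 - a 0 1 * a 1 0 = 0 ∧ a 0 2 * a 2 0 - a 0 0 * a 2 2 = 0 ∧
      a 1 0 * a 2 3 - a 1 3 * a 2 0 = 0 ∧ a 2 1 = 0 ∧ a 1 2 = 0 ∧ a 0 3 = 0) ∧
    a 1 1 * a 0 2 * a 2 3 - a 0 1 * a 2 2 * a 1 3 = 1 := by
  decide

end Summit.ResolutionOfSingularities.ResolutionOfSingularities.Cruxes.MatroidCellRes.Disproof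

end
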